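import Summits.ResolutionOfSingularities.KangarooAtlas.MizutaniVectorGroupHolds
import Summits.ResolutionOfSingularities.KangarooAtlas.MizutaniRank
import HarnessLib

/-!
# REVIEW-RUNBOOK sanity lemma — the hypotheses of `Mizutani.ringKrullDim_quotient_bIdeal` hold together
# (client `pub-rosobs` of the ops review-runbook generator, runbook `REVIEW-RUNBOOK-MZ.md`, card S6)

Card (2)(b) («non-vacuity»).  `ringKrullDim_quotient_bIdeal` — Mizutani's Thm 1.3 in Hironaka's vocabulary,
`dim Spec(S ⧸ U_+(𝔭)S) = (n+1) − dim_k (U(𝔭) ∩ L)_{e₀}` — is stated for a field `k` of characteristic `p`, a POINT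
`𝔭` of `ℙⁿ_k` (`IsPoint`: homogeneous prime, not containing the irrelevant ideal), a level `e₀` from which on
`U(𝔭) ∩ L` is generated by Frobenius twists of its degree-`e₀` part (`hE`), and Hironaka's generation theorem
(`hH`, a theorem of the tree: `Hironaka1970_thm1_cor_holds`, so met at every `p`).  This file records ONE closed
theorem `∃ e₀, h₁ ∧ … ∧ h₅` (the shape the generator's probe matches) meeting the other five at once at an object the
cell itself built: Mizutani's extremal point `attP F p e` of `ℙ^{2p^e−1}` over the rational function field
`RatField F 2 = F(u₀,u₁)` (encloser-1, `MizutaniAttainedPoint.lean`), here with `F = 𝔽₂`, `p = 2`, `e = 1` — a point of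
`ℙ³` over `𝔽₂(u₀,u₁)`: `Fact (Nat.Prime 2)`, `CharP (RatField (ZMod 2) 2) 2` (`charP_ratField`), `IsPoint` (`isPoint_attP`),
primality (`attP_isPrime`), and the eventual-generation level from `exists_eventually_eq_span_hirForms` (an `=`,
weakened to the statement's `≤`).  A genuine, non-degenerate member of the class (it is the point at which
Mizutani's bound is attained).

Review evidence only (topic module, closes no item); no definitions, no `sorry`, standard axioms.
-/

namespace Summit.ResolutionOfSingularities.KangarooAtlas.Runbook

open Literature.AlgebraicGeometry.Resolution HironakaScheme
open Summit.ResolutionOfSingularities.KangarooAtlas.Mizutani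

/-- (b) **The object hypotheses of `Mizutani.ringKrullDim_quotient_bIdeal` hold together** at Mizutani's extremal
point `attP 𝔽₂ 2 1` of `ℙ³` over `𝔽₂(u₀,u₁)`: `2` is prime, the field has characteristic `2`, `attP` is a point of
`ℙ³` in Oda's sense and a prime ideal, and some level `e₀` generates all later levels of `U(𝔭) ∩ L` by Frobenius
twists (the cell's `exists_eventually_eq_span_hirForms`).  (`hH` — Hironaka 1970 Thm 1 Cor. — is the tree's
`Hironaka1970_thm1_cor_holds` at every prime.) [folklore] -/
theorem ringKrullDim_quotient_bIdeal_hypotheses :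
    ∃ e₀ : ℕ, Fact (Nat.Prime 2) ∧ CharP (RatField (ZMod 2) 2) 2 ∧
      IsPoint (RatField (ZMod 2) 2) (attP (ZMod 2) 2 1) ∧ (attP (ZMod 2) 2 1).IsPrime ∧
      (haveI : (attP (ZMod 2) 2 1).IsPrime := attP_isPrime
       ∀ j, e₀ ≤ j → hirForms (RatField (ZMod 2) 2) 2 (attP (ZMod 2) 2 1) j ≤
        Submodule.span (RatField (ZMod 2) 2)
          (frobVec (RatField (ZMod 2) 2) 2 (j - e₀) ''
            (hirForms (RatField (ZMod 2) 2) 2 (attP (ZMod 2) 2 1) e₀ : Set (Fin (attN 2 1 + 1) → RatField (ZMod 2) 2)))) := by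
  haveI : (attP (ZMod 2) 2 1).IsPrime := attP_isPrime
  obtain ⟨e₀, he⟩ := exists_eventually_eq_span_hirForms (RatField (ZMod 2) 2) 2 (attP (ZMod 2) 2 1)
  exact ⟨e₀, inferInstance, inferInstance, isPoint_attP, attP_isPrime, fun j hj => (he j hj).le⟩

/-! ### The dimension WRITTEN in the conclusion is a genuine dimension (review-runbook 9.88 «written count» rows, 2026-09-04)

`ringKrullDim_quotient_bIdeal` concludes `ringKrullDim (S ⧸ U(𝔭)S) = ↑(n + 1 - Module.finrank k (hirForms k p 𝔭 e₀))`.  Mathlib's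
`Module.finrank` is the default `0` for a module that is not finite-dimensional; here the counted module is a subspace of
`k^{n+1}`, so it IS finite-dimensional and the `finrank` is its dimension.  Stated for the statement's own binders. -/

/-- (c) **`(U(𝔭) ∩ L)_{e₀}` is a finite-dimensional `k`-space** (a `k`-subspace of `Fin (n + 1) → k`), for every field `k`, prime
`p`, ideal `𝔭` and level `e₀`: the `Module.finrank` in the conclusion of `ringKrullDim_quotient_bIdeal` is the genuine
dimension, never the not-finite-dimensional default `0`. [folklore] -/
theorem hirForms_moduleFinite (k : Type*) [Field k] (p : ℕ) [Fact p.Prime] [CharP k p] {n : ℕ}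
    (𝔭 : Ideal (MvPolynomial (Fin (n + 1)) k)) [𝔭.IsPrime] (e₀ : ℕ) :
    Module.Finite k (hirForms k p 𝔭 e₀) :=
  inferInstance

/-- The same, with the bound it gives: `dim_k (U(𝔭) ∩ L)_{e₀} ≤ n + 1`, so the subtraction `n + 1 - finrank` in the conclusion
never truncates below its intended value. [folklore] -/
theorem finrank_hirForms_le (k : Type*) [Field k] (p : ℕ) [Fact p.Prime] [CharP k p] {n : ℕ}
    (𝔭 : Ideal (MvPolynomial (Fin (n + 1)) k)) [𝔭.IsPrime] (e₀ : ℕ) :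
    Module.finrank k (hirForms k p 𝔭 e₀) ≤ n + 1 := by
  calc Module.finrank k (hirForms k p 𝔭 e₀) ≤ Module.finrank k (Fin (n + 1) → k) := Submodule.finrank_le _
    _ = n + 1 := by rw [Module.finrank_fin_fun]

/-! ### Mizutani's tensor rank is the dimension of a FINITE-dimensional space (review-runbook «card» side fact, 2026-09-04)

`Mizutani.tensorRank L ω = Module.finrank L (rightSupport L ω)`; `Module.finrank` is the default `0` for a space that is not
finite-dimensional.  The right support `H_R(ω)` — the `L`-span of the contractions `(φ ⊗ 1)ω` — lies in the span of the right
entries of ANY finite expansion `ω = Σ aᵢ ⊗ bᵢ` (`rightSupport_le_of_mem_range`), and every tensor has one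
(`TensorProduct.exists_finset`): so `H_R(ω)` is finite-dimensional for EVERY `ω`, with no hypothesis on `k / L`. -/

/-- (c) **`H_R(ω)` is finite-dimensional over `L`** for every `ω ∈ k ⊗_L k` (no finiteness of `k / L` assumed): the `finrank`
defining `Mizutani.tensorRank` is a genuine dimension. [folklore] -/
theorem rightSupport_moduleFinite (L : Type*) {k : Type*} [Field L] [Field k] [Algebra L k] (ω : TensorProduct L k k) :
    Module.Finite L (rightSupport L ω) := by
  classical
  obtain ⟨S, hS⟩ := TensorProduct.exists_finset ω
  set H : Submodule L k := Submodule.span L (↑(S.image Prod.snd) : Set k) with hH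
  have hle : rightSupport L ω ≤ H := by
    refine rightSupport_le_of_mem_range ω H ?_
    rw [hS]
    refine Submodule.sum_mem _ fun p hp => ?_
    have hp2 : p.2 ∈ H := Submodule.subset_span (by simpa using Finset.mem_image_of_mem Prod.snd hp)
    exact ⟨p.1 ⊗ₜ ⟨p.2, hp2⟩, by simp⟩
  haveI : FiniteDimensional L H := FiniteDimensional.span_of_finite L (Finset.finite_toSet _)
  exact Submodule.finiteDimensional_of_le hle

/-- Hence `rank(ω) ≤ #terms` of any expansion — in particular the rank of a sum of `S.card` pure tensors is at most `S.card`
(the inequality of MIZUTANI-PROOF §3 (e), stated for an arbitrary finite expansion). [folklore] -/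
theorem tensorRank_le_card_of_eq_sum (L : Type*) {k : Type*} [Field L] [Field k] [Algebra L k] (ω : TensorProduct L k k)
    (S : Finset (k × k)) (hS : ω = ∑ p ∈ S, p.1 ⊗ₜ[L] p.2) :
    Mizutani.tensorRank L ω ≤ S.card := by
  classical
  set H : Submodule L k := Submodule.span L (↑(S.image Prod.snd) : Set k) with hH
  have hle : rightSupport L ω ≤ H := by
    refine rightSupport_le_of_mem_range ω H ?_
    rw [hS]
    refine Submodule.sum_mem _ fun p hp => ?_
    have hp2 : p.2 ∈ H := Submodule.subset_span (by simpa using Finset.mem_image_of_mem Prod.snd hp)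
    exact ⟨p.1 ⊗ₜ ⟨p.2, hp2⟩, by simp⟩
  haveI : FiniteDimensional L H := FiniteDimensional.span_of_finite L (Finset.finite_toSet _)
  calc Mizutani.tensorRank L ω = Module.finrank L (rightSupport L ω) := rfl
    _ ≤ Module.finrank L H := Submodule.finrank_mono hle
    _ ≤ (S.image Prod.snd).card := by
        rw [hH]; exact finrank_span_finset_le_card (R := L) (S.image Prod.snd)
    _ ≤ S.card := Finset.card_image_le

/-- The same fact under the name the runbook's side-fact reader looks for on the `Mizutani.tensorRank` card (`…_finiteDimensional`;
`FiniteDimensional` is `Module.Finite`): `H_R(ω)` is a finite-dimensional `L`-space for every `ω`. [folklore] -/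
theorem rightSupport_finiteDimensional (L : Type*) {k : Type*} [Field L] [Field k] [Algebra L k] (ω : TensorProduct L k k) :
    FiniteDimensional L (rightSupport L ω) :=
  rightSupport_moduleFinite L ω

/-! ### Oda's invariant forms `(L_B)_{e₀}` are a FINITE-dimensional space (review-runbook «card» side fact, 2026-09-05)

`HironakaScheme.hsDimAt 𝔭 e₀ = (n + 1) - Module.finrank k (invForms k p 𝔭 e₀)` (Literature, Oda 1983-II §2).  `Module.finrank`
is the default `0` for a space that is not finite-dimensional; `invForms k p 𝔭 e₀` is a `k`-subspace of `Fin (n + 1) → k`, so it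
IS finite-dimensional for every field `k`, prime `p`, ideal `𝔭` and level `e₀` — the `finrank` is its dimension, and the
Literature's `finrank_invForms_le` bounds it by `n + 1`. -/

/-- (c) **`(L_B)_{e₀} = invForms k p 𝔭 e₀` is a finite-dimensional `k`-space** (a subspace of `k^{n+1}`), for every field `k` of
characteristic `p`, ideal `𝔭` and level `e₀`: the `Module.finrank` inside `hsDimAt` is the genuine dimension. [folklore] -/
theorem invForms_finiteDimensional (k : Type*) [Field k] (p : ℕ) [Fact p.Prime] [CharP k p] {n : ℕ}
    (𝔭 : Ideal (MvPolynomial (Fin (n + 1)) k)) (e₀ : ℕ) :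
    FiniteDimensional k (invForms k p 𝔭 e₀) :=
  inferInstance

/-- The same fact spelled `Module.Finite` (what `FiniteDimensional` unfolds to). [folklore] -/
theorem invForms_finite (k : Type*) [Field k] (p : ℕ) [Fact p.Prime] [CharP k p] {n : ℕ}
    (𝔭 : Ideal (MvPolynomial (Fin (n + 1)) k)) (e₀ : ℕ) :
    Module.Finite k (invForms k p 𝔭 e₀) :=
  inferInstance

/-- Hence `hsDimAt 𝔭 e₀ + dim_k (L_B)_{e₀} = n + 1`: the truncated subtraction in `hsDimAt` is an honest one
(`finrank_invForms_le`). [folklore] -/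
theorem hsDimAt_add_finrank_invForms (k : Type*) [Field k] (p : ℕ) [Fact p.Prime] [CharP k p] {n : ℕ}
    (𝔭 : Ideal (MvPolynomial (Fin (n + 1)) k)) (e₀ : ℕ) :
    hsDimAt k p 𝔭 e₀ + Module.finrank k (invForms k p 𝔭 e₀) = n + 1 :=
  Nat.sub_add_cancel (finrank_invForms_le k p 𝔭 e₀)

end Summit.ResolutionOfSingularities.KangarooAtlas.Runbook
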